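import Summits.BirchSwinnertonDyer.BirchSwinnertonDyer.Theses.PrintCf2
import Summits.BirchSwinnertonDyer.BirchSwinnertonDyer.Theorems.PrintCf2SplitBadTwistCurrency
import Summits.BirchSwinnertonDyer.BirchSwinnertonDyer.Theorems.GoldfeldAllTwistsTwoConverseTwinGenusDescentMinimal
import Summits.BirchSwinnertonDyer.BirchSwinnertonDyer.Theorems.PrintCf2SplitBadTwoUpperHalfOfFactsRubinKatzFrameTwo
import Summits.BirchSwinnertonDyer.BirchSwinnertonDyer.Theorems.PrintCf2SplitBadTwoRankOneOfFactsGlue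
import Summits.BirchSwinnertonDyer.Rank1Residual.X12.O11.RamifiedRelativeRubinFormulaLineZp
import Literature.NumberTheory.EllipticCurves.DeShalit1987.KatzPAdicLFunction
import Literature.NumberTheory.GaloisRepresentations.CMTypeHeckeCharacter
import Literature.NumberTheory.EllipticCurves.HeegnerPoints
import Literature.NumberTheory.EllipticCurves.ComplexMultiplicationDeuringGrossencharacter
import HarnessLib

/-!
# The Rubin / GL₁ road to crux `PrintCf2.SplitBadTwoRankOneOfFacts` (stmt-BirchSwinnertonDyer-20368) and to its two
# halves `SplitBadTwoUpperHalfOfFacts` (27850) / `SplitBadTwoLowerHalfOfFacts` (27851): the composition of the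
# ideator line `rubin_value_two` (v4) AS A TREE THEOREM, with its frame stub S1 DISCHARGED

Width seat -w3 g2 of cell `bsd-print-cf2` (planner ASSIGN rev 26: the Rubin road to the upper half). The line
`Cruxes/SplitBadTwoRankOneOfFacts/Lines/rubin_value_two.lean` (bsd-idea-7 g4–g6; critic idea-crit-10 V#40/V#50/V#58
PASS-WITH-PRICE) reads `BSD(W,2)` for the class `49a1^{(d)}`, `d ≢ 1 (mod 4)`, off Rubin's split-prime programme at
`p = 2` over `K = ℚ(√−7)`: S0 four PRINTS · S1 FRAMES · S2 the 2-ADIC RUBIN VALUE FORMULA (`ord₂ G(0)` = `ord₂` of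
`Ш_an·∏c_ℓ/#tors²` plus `2·ord₂ log` up to a class constant `e_A([d]₂)`) · S3 ELLIPTIC-UNIT CONTROL (`ord₂ G(0)` = the
same with `#Ш[2^∞]`, constant `e_B([d]₂)`) · S4 one certified rank-one ANCHOR per 2-adic square class (two in tree,
four by kit). This file lands the line's kernel-checked COMPOSITION in the tree, keyed BY NAME to the crux and to both
children, with S1 no longer a hypothesis: it is the tree theorem `RubinValueTwo.stub_katzFrame_two` (p637259). What
remains displayed as hypotheses is exactly the research/print/kit content of the road:

* `h0` — S0: de Shalit II Thm. 4.14 (`p = 2` included), Deuring's Grössencharacter, bsd.S31 (Creutz–Miller,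
  `N < 5000`), Modularity (version L) — four NAMED FACTS, by name;
* `h2` — S2 `stub_rubinValueFormula_two` [research-L; Rubin 1992 Cor. 10.2 is printed for split GOOD ODD `p`; here
  `ψ_W` is RAMIFIED above `2`];
* `h3` — S3 `stub_ellipticUnitControl_two` [research-L; Iwasawa inputs printed at `2` (Johnson-Leung–Kings 2011 Thm.
  5.2, Müller 2020 Thm. 1.1, Kezuka 2019), the rank-one descent at the additive `2` is not];
* `h4` — S4b `stub_anchor_two_kit` [computation: one certified rank-one `BSD₂` anchor for each of the four 2-adic classes
  `d′ ≢ 7 (mod 8)`, all of conductor `≥ 19600`].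

The anchors S4a (`d′ ≡ 7 (mod 8)`: `d₀ = −1`, `N = 784`; `d₀ = −2`, `N = 3136`) are re-proved here from bsd.S31 +
Modularity through cell bsd-goldfeld's B49 package (`anchor_two_inTree`, text = the line's, no `sorry`). The one-sided
remark for the pen: a ONE-SIDED S3 (Euler-system inequality `m ≥ 2(…) + e_B`) together with S2 and an anchor yields only
`e_A − e_B ≥ 0` on the class and NOT the upper half — the anchor trick needs the two-sided S3 (or explicit constants);
this is why the Rubin road is keyed to the parent and to BOTH halves at once (`…UpperHalf…_of_laws`, `…LowerHalf…_of_laws`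
below are the parent composed with the conjunct split `halves_of_splitBadTwoRankOneOfFacts`, p635724).
CONDITIONAL on `h0 h2 h3 h4` exactly as displayed; nothing about BSD is asserted. BSD is not proved by any of this; no
summit statement is proved by this seat.
-/

set_option autoImplicit false
-- D-0017 layout: summit = sub-problem, so `Summit.BirchSwinnertonDyer.BirchSwinnertonDyer.…` repeats a path component.
set_option linter.dupNamespace false

noncomputable section

open scoped Classical
open NumberField IsDedekindDomain Field WeierstrassCurve
open Literature.NumberTheory.GaloisRepresentations Literature.NumberTheory.EllipticCurves
open Literature.NumberTheory.EllipticCurves.Rank1Residual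
open Literature.NumberTheory.EllipticCurves.DeShalit1987
open Summit.BirchSwinnertonDyer.BirchSwinnertonDyer.Theses.PrintCf2

namespace Summit.BirchSwinnertonDyer.BirchSwinnertonDyer.Theorems.PrintCf2.RubinValueTwo

/-! ## §1 The two in-tree anchors (S4a of the line, text verbatim) -/

/-- **S4a — THE TWO IN-TREE ANCHORS, DISCHARGED (v4; no `sorry`).** For every admissible `d` whose 2-adic
class key `(d mod 2, d′ mod 8)` has `d′ ≡ 7 (mod 8)` — the classes `[−1]₂` (odd `d ≡ 7 (8)`) and `[−2]₂`
(`d = 2d′`, `d′ ≡ 7 (8)`) — the anchor is `d₀ = −1`, `W₀ = [0, −21, 0, 112, 0]` (`49a1^{(−1)}`, `N = 784`), resp.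
`d₀ = −2`, `W₀ = [0, −42, 0, 448, 0]` (`49a1^{(−2)}`, `N = 3136`): globally minimal (Kraus at `2`, kernel), a model
of `cm7^{(d₀)}` (the two-torsion change `(1/2, −2k, 0, 0)`, kernel), of Mordell–Weil rank `1` with `Ш[2] = 0`
(2-descent, kernel: cell bsd-goldfeld LINE B49 files I–III), hence — BY NAME from bsd.S31 (`N < 5000`) and
Modularity — `BSDTriple`, `r_an = 1` and `BSD(W₀, 2)` (Miller: BSD ⟹ `BSD(E,p)` for every `p`).
[cite: CreutzMiller2012, Thm. 1.1 and the remark following it] [cite: Miller2011LMS, §1, Def. 1.1, Thm. 1.2]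
[cite: Kraus1989, Prop. 2] -/
theorem anchor_two_inTree (hS31 : bsdTriple_of_rank_le_one_of_conductor_lt)
    (hnew : ModularForms.exists_isNewformOf) :
    ∀ (d : ℤ), d ≠ 0 → Squarefree d → d % 4 ≠ 1 → (d / (2 - d % 2)) % 8 = 7 →
    ∃ (d₀ : ℤ) (W₀ : WeierstrassCurve ℚ) (_ : W₀.IsElliptic) (_ : W₀.IsGloballyMinimal)
      (C₀ : VariableChange ℚ),
      d₀ ≠ 0 ∧ Squarefree d₀ ∧ d₀ % 4 ≠ 1 ∧ d₀ % 2 = d % 2 ∧ (d₀ / (2 - d₀ % 2)) % 8 = (d / (2 - d % 2)) % 8 ∧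
      C₀ • W₀ = cm7.quadraticTwist (d₀ : ℚ) ∧ W₀.analyticRank = 1 ∧ BSDp W₀ 2 := by
  intro d _hd0 _hsq _hd4 hkey
  rcases Int.emod_two_eq_zero_or_one d with hpar | hpar
  · -- even `d = 2d′`, `d′ ≡ 7 (mod 8)`: anchor `d₀ = −2`, `W₀ = [0, −42, 0, 448, 0]`, `N = 3136`
    haveI := Summit.BirchSwinnertonDyer.BirchSwinnertonDyer.Theorems.GoldfeldGoodTwists.isElliptic_twoTorsionModel_neg_two
    haveI := Summit.BirchSwinnertonDyer.BirchSwinnertonDyer.Theorems.GoldfeldGoodTwists.isGloballyMinimal_twoTorsionModel_neg_two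
    refine ⟨-2, ⟨0, -42, 0, 448, 0⟩, inferInstance, inferInstance,
      (⟨(Units.mk0 (2 : ℚ) two_ne_zero)⁻¹, -4, 0, 0⟩ : VariableChange ℚ)⁻¹,
      by decide, ?_, by decide, ?_, ?_, ?_, ?_, ?_⟩
    · exact Int.squarefree_natAbs.mp (by simpa using Nat.prime_two.squarefree)
    · rw [hpar]; decide
    · rw [hkey]; decide
    · rw [show ((-2 : ℤ) : ℚ) = -2 by norm_num,
        ← Summit.BirchSwinnertonDyer.BirchSwinnertonDyer.Theorems.GoldfeldGoodTwists.twoTorsionChange_smul_cm7_quadraticTwist_neg_two_rat,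
        inv_smul_smul]
    · exact (Summit.BirchSwinnertonDyer.BirchSwinnertonDyer.Theorems.GoldfeldGoodTwists.analyticRank_shaFinite_odd_twoTorsionModel_neg_two
        hS31 hnew).1
    · exact forall_bsdp_of_bsdTriple' _
        (Summit.BirchSwinnertonDyer.BirchSwinnertonDyer.Theorems.GoldfeldGoodTwists.bsdTriple_twoTorsionModel_neg_two
          hS31 hnew) 2 Nat.prime_two
  · -- odd `d ≡ 7 (mod 8)`: anchor `d₀ = −1`, `W₀ = [0, −21, 0, 112, 0]`, `N = 784`
    haveI := Summit.BirchSwinnertonDyer.BirchSwinnertonDyer.Theorems.GoldfeldGoodTwists.isElliptic_twoTorsionModel_neg_one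
    haveI := Summit.BirchSwinnertonDyer.BirchSwinnertonDyer.Theorems.GoldfeldGoodTwists.isGloballyMinimal_twoTorsionModel_neg_one
    refine ⟨-1, ⟨0, -21, 0, 112, 0⟩, inferInstance, inferInstance,
      (⟨(Units.mk0 (2 : ℚ) two_ne_zero)⁻¹, -2, 0, 0⟩ : VariableChange ℚ)⁻¹,
      by decide, ?_, by decide, ?_, ?_, ?_, ?_, ?_⟩
    · exact Int.squarefree_natAbs.mp (by simp)
    · rw [hpar]; decide
    · rw [hkey]; decide
    · rw [show ((-1 : ℤ) : ℚ) = -1 by norm_num,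
        ← Summit.BirchSwinnertonDyer.BirchSwinnertonDyer.Theorems.GoldfeldGoodTwists.twoTorsionChange_smul_cm7_quadraticTwist_neg_one_rat,
        inv_smul_smul]
    · exact (Summit.BirchSwinnertonDyer.BirchSwinnertonDyer.Theorems.GoldfeldGoodTwists.analyticRank_shaFinite_odd_twoTorsionModel_neg_one
        hS31 hnew).1
    · exact forall_bsdp_of_bsdTriple' _
        (Summit.BirchSwinnertonDyer.BirchSwinnertonDyer.Theorems.GoldfeldGoodTwists.bsdTriple_twoTorsionModel_neg_one
          hS31 hnew) 2 Nat.prime_two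

/-- **S4 assembled (no `sorry`): an anchor for EVERY admissible `d`** — the in-tree anchors S4a on the keys
`d′ ≡ 7 (mod 8)`, the stub S4b elsewhere.  This is v3's `stub_anchor_two` statement, now a consequence.
[cite: Miller2011LMS, Def. 1.1] -/
theorem anchor_two_of_inTree_of_kit (hS31 : bsdTriple_of_rank_le_one_of_conductor_lt)
    (hnew : ModularForms.exists_isNewformOf)
    (h4 : ∀ (d : ℤ), d ≠ 0 → Squarefree d → d % 4 ≠ 1 → (d / (2 - d % 2)) % 8 ≠ 7 →
      ∃ (d₀ : ℤ) (W₀ : WeierstrassCurve ℚ) (_ : W₀.IsElliptic) (_ : W₀.IsGloballyMinimal)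
        (C₀ : VariableChange ℚ),
        d₀ ≠ 0 ∧ Squarefree d₀ ∧ d₀ % 4 ≠ 1 ∧ d₀ % 2 = d % 2 ∧ (d₀ / (2 - d₀ % 2)) % 8 = (d / (2 - d % 2)) % 8 ∧
        C₀ • W₀ = cm7.quadraticTwist (d₀ : ℚ) ∧ W₀.analyticRank = 1 ∧ BSDp W₀ 2) :
    ∀ (d : ℤ), d ≠ 0 → Squarefree d → d % 4 ≠ 1 →
    ∃ (d₀ : ℤ) (W₀ : WeierstrassCurve ℚ) (_ : W₀.IsElliptic) (_ : W₀.IsGloballyMinimal)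
      (C₀ : VariableChange ℚ),
      d₀ ≠ 0 ∧ Squarefree d₀ ∧ d₀ % 4 ≠ 1 ∧ d₀ % 2 = d % 2 ∧ (d₀ / (2 - d₀ % 2)) % 8 = (d / (2 - d % 2)) % 8 ∧
      C₀ • W₀ = cm7.quadraticTwist (d₀ : ℚ) ∧ W₀.analyticRank = 1 ∧ BSDp W₀ 2 := by
  intro d hd0 hsq hd4
  by_cases hk : (d / (2 - d % 2)) % 8 = 7
  · exact anchor_two_inTree hS31 hnew d hd0 hsq hd4 hk
  · exact h4 d hd0 hsq hd4 hk

/-! ## §2 The composition: S0 ∧ S2 ∧ S3 ∧ S4b ⟹ the crux BY NAME (S1 = `stub_katzFrame_two`, a tree theorem) -/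

/-- **The Rubin road: S0 (four prints) ∧ S2 (2-adic Rubin value formula) ∧ S3 (elliptic-unit control at 2) ∧ S4b (kit
anchors) ⟹ `PrintCf2.SplitBadTwoRankOneOfFacts`**, the frame stub S1 being the tree theorem `stub_katzFrame_two`
(fed GZK from the crux's bundle `𝔅_split` and the two facts of S0). At the member and at its anchor (same 2-adic class
`[d]₂`) the two laws give `2·ord₂ q + e_A = 2·ord₂ #Ш[2^∞] + e_B` (the `log`, Tamagawa and torsion terms cancel);
`BSD(W₀,2)` at the anchor forces `e_A = e_B` on the class, whence `ord₂ Ш_an(W) = ord₂ #Ш(W)[2^∞]` (rank and finiteness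
from GZK); class ↔ twists is `splitBadTwoRankOneOfFacts_iff_goldfeld19140` / `GoldfeldGoodTwists.bsdTwoCMSevenAdditiveRankOne_of_twists`.
Proof text = the line's `SplitBadTwoRankOneOfFacts_of` with `h1 := stub_katzFrame_two`. CONDITIONAL on `h0 h2 h3 h4`.
[cite: Rubin1992, Cor. 10.2 and Cor. 10.3 (shape)] [cite: deShalit1987, II Thm. 4.14 (p. 71)] -/
theorem splitBadTwoRankOneOfFacts_of_laws
    (h0 : DeShalit1987.thmII414_exists_katzBranch ∧ Deuring_exists_heckeCharacter_of_maximalCM ∧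
      bsdTriple_of_rank_le_one_of_conductor_lt ∧ ModularForms.exists_isNewformOf)
    (h2 : ∃ eA : ℤ → ℤ → ℤ,
      ∀ (d : ℤ), d ≠ 0 → Squarefree d → d % 4 ≠ 1 →
      ∀ (W : WeierstrassCurve ℚ) [W.IsElliptic] [W.IsGloballyMinimal] (C : VariableChange ℚ),
        C • W = cm7.quadraticTwist (d : ℚ) → W.analyticRank = 1 →
      ∀ (K : Type) [Field K] [NumberField K], IsImaginaryQuadratic K →
      ∀ (v vbar : HeightOneSpectrum (𝓞 K)),
        ((2 : ℕ) : 𝓞 K) ∈ v.asIdeal → ((2 : ℕ) : 𝓞 K) ∈ vbar.asIdeal → vbar ≠ v →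
      ∀ (ι : PadicAlgCl 2 ≃+* ℂ),
        (∀ (w : InfinitePlace K) (k : 𝓞 K), k ∈ v.asIdeal ↔ ‖ι.symm (w.embedding (k : K))‖ < 1) →
      ∀ (c : K ≃ₐ[ℚ] K), c ≠ 1 →
      ∀ (ψ : HeckeCharacter K), ψ.HasInfinityType (fun _ ↦ 1) (fun _ ↦ 0) →
        (∀ s : ℂ, 3 / 2 < s.re → heckeLFunction ψ s = W.LSeries s) →
      ∀ (S : Finset (HeightOneSpectrum (𝓞 K))),
        (∀ w : HeightOneSpectrum (𝓞 K), w ∈ S ↔ (¬ ψ.IsUnramifiedAt w ∧ w ≠ v ∧ w ≠ vbar)) →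
      ∀ (κ : ZpExtension K 2) (γ : absoluteGaloisGroup K), κ.IsAnticyclotomic → κ.IsTopGenerator γ →
      ∀ (Ω δ : ℂ) (Ωp : (unrIntegers 2)ˣ) (G : PowerSeries (PadicComplexInt 2)),
        Ω ≠ 0 → (δ ^ 2 = (NumberField.discr K : ℂ) ∨ δ ^ 2 = -(NumberField.discr K : ℂ)) →
        IsKatzBranch ι v vbar S κ γ (HeckeCharacter.galConj c ψ)⁻¹ Ω δ ((Ωp : unrIntegers 2) : ℂ_[2]) G →
      ∀ (P : W.toAffine.Point) (c₀ : ℕ) (ℓ : ℤ),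
        ¬ IsOfFinAddOrder P →
        (∀ R : W.toAffine.Point, ∃ (k : ℤ) (T : W.toAffine.Point), IsOfFinAddOrder T ∧ R = k • P + T) →
        c₀ ≠ 0 → (W.baseChange ℚ_[2]).IsInReductionKernel (c₀ • W.toPadicPoint 2 P) →
        ‖(W.baseChange ℚ_[2]).padicLogPoint (c₀ • W.toPadicPoint 2 P) / (c₀ : ℚ_[2])‖ = (2 : ℝ) ^ (-ℓ) →
      ∃ q : ℚ, shaAn W = (q : ℂ) ∧
        ∀ m : ℤ, ‖((PowerSeries.constantCoeff G : PadicComplexInt 2) : ℂ_[2])‖ = (2 : ℝ) ^ (-(m : ℝ) / 2) →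
          m = 2 * (padicValRat 2 q + (padicValNat 2 W.tamagawaProduct : ℤ)
                - 2 * (padicValNat 2 W.torsionOrder : ℤ) + 2 * ℓ) + eA (d % 2) ((d / (2 - d % 2)) % 8))
    (h3 : ∃ eB : ℤ → ℤ → ℤ,
      ∀ (d : ℤ), d ≠ 0 → Squarefree d → d % 4 ≠ 1 →
      ∀ (W : WeierstrassCurve ℚ) [W.IsElliptic] [W.IsGloballyMinimal] (C : VariableChange ℚ),
        C • W = cm7.quadraticTwist (d : ℚ) → W.analyticRank = 1 →
      ∀ (K : Type) [Field K] [NumberField K], IsImaginaryQuadratic K →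
      ∀ (v vbar : HeightOneSpectrum (𝓞 K)),
        ((2 : ℕ) : 𝓞 K) ∈ v.asIdeal → ((2 : ℕ) : 𝓞 K) ∈ vbar.asIdeal → vbar ≠ v →
      ∀ (ι : PadicAlgCl 2 ≃+* ℂ),
        (∀ (w : InfinitePlace K) (k : 𝓞 K), k ∈ v.asIdeal ↔ ‖ι.symm (w.embedding (k : K))‖ < 1) →
      ∀ (c : K ≃ₐ[ℚ] K), c ≠ 1 →
      ∀ (ψ : HeckeCharacter K), ψ.HasInfinityType (fun _ ↦ 1) (fun _ ↦ 0) →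
        (∀ s : ℂ, 3 / 2 < s.re → heckeLFunction ψ s = W.LSeries s) →
      ∀ (S : Finset (HeightOneSpectrum (𝓞 K))),
        (∀ w : HeightOneSpectrum (𝓞 K), w ∈ S ↔ (¬ ψ.IsUnramifiedAt w ∧ w ≠ v ∧ w ≠ vbar)) →
      ∀ (κ : ZpExtension K 2) (γ : absoluteGaloisGroup K), κ.IsAnticyclotomic → κ.IsTopGenerator γ →
      ∀ (Ω δ : ℂ) (Ωp : (unrIntegers 2)ˣ) (G : PowerSeries (PadicComplexInt 2)),
        Ω ≠ 0 → (δ ^ 2 = (NumberField.discr K : ℂ) ∨ δ ^ 2 = -(NumberField.discr K : ℂ)) →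
        IsKatzBranch ι v vbar S κ γ (HeckeCharacter.galConj c ψ)⁻¹ Ω δ ((Ωp : unrIntegers 2) : ℂ_[2]) G →
      ∀ (P : W.toAffine.Point) (c₀ : ℕ) (ℓ : ℤ),
        ¬ IsOfFinAddOrder P →
        (∀ R : W.toAffine.Point, ∃ (k : ℤ) (T : W.toAffine.Point), IsOfFinAddOrder T ∧ R = k • P + T) →
        c₀ ≠ 0 → (W.baseChange ℚ_[2]).IsInReductionKernel (c₀ • W.toPadicPoint 2 P) →
        ‖(W.baseChange ℚ_[2]).padicLogPoint (c₀ • W.toPadicPoint 2 P) / (c₀ : ℚ_[2])‖ = (2 : ℝ) ^ (-ℓ) →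
      ∃ m : ℤ, ‖((PowerSeries.constantCoeff G : PadicComplexInt 2) : ℂ_[2])‖ = (2 : ℝ) ^ (-(m : ℝ) / 2) ∧
        m = 2 * ((padicValNat 2 (Nat.card (AddCommGroup.primaryComponent W.sha 2)) : ℤ)
              + (padicValNat 2 W.tamagawaProduct : ℤ)
              - 2 * (padicValNat 2 W.torsionOrder : ℤ) + 2 * ℓ) + eB (d % 2) ((d / (2 - d % 2)) % 8))
    (h4 : ∀ (d : ℤ), d ≠ 0 → Squarefree d → d % 4 ≠ 1 → (d / (2 - d % 2)) % 8 ≠ 7 →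
      ∃ (d₀ : ℤ) (W₀ : WeierstrassCurve ℚ) (_ : W₀.IsElliptic) (_ : W₀.IsGloballyMinimal)
        (C₀ : VariableChange ℚ),
        d₀ ≠ 0 ∧ Squarefree d₀ ∧ d₀ % 4 ≠ 1 ∧ d₀ % 2 = d % 2 ∧ (d₀ / (2 - d₀ % 2)) % 8 = (d / (2 - d % 2)) % 8 ∧
        C₀ • W₀ = cm7.quadraticTwist (d₀ : ℚ) ∧ W₀.analyticRank = 1 ∧ BSDp W₀ 2) :
    SplitBadTwoRankOneOfFacts := by
  refine Summit.BirchSwinnertonDyer.BirchSwinnertonDyer.Theorems.PrintCf2.splitBadTwoRankOneOfFacts_iff_goldfeld19140.2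
    fun hB ↦ ?_
  refine Summit.BirchSwinnertonDyer.BirchSwinnertonDyer.Theorems.GoldfeldGoodTwists.bsdTwoCMSevenAdditiveRankOne_of_twists
    hB.2.2.1 hB.1 hB.2.1 ?_
  intro d hd0 hsq hd4 W _ _ C hC hr
  have hGZK := hB.1
  obtain ⟨eA, hA⟩ := h2
  obtain ⟨eB, hBB⟩ := h3
  -- the member
  obtain ⟨K, iF, iN, v, vbar, ι, cc, ψ, S, κ, γ, Ω, δ, Ωp, G, P, c₀, ℓ, hK, hv, hvbar, hne, hι, hcc, hψ,
    hL, hS, hac, hγ, hΩ, hδ, hG, hP, hgen, hc₀, hker, hlog⟩ := stub_katzFrame_two hGZK h0.1 h0.2.1 d hd0 hsq hd4 W C hC hr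
  obtain ⟨q, hq, hAq⟩ := hA d hd0 hsq hd4 W C hC hr K hK v vbar hv hvbar hne ι hι cc hcc ψ hψ hL S hS κ γ
    hac hγ Ω δ Ωp G hΩ hδ hG P c₀ ℓ hP hgen hc₀ hker hlog
  obtain ⟨m, hm, hBm⟩ := hBB d hd0 hsq hd4 W C hC hr K hK v vbar hv hvbar hne ι hι cc hcc ψ hψ hL S hS κ γ
    hac hγ Ω δ Ωp G hΩ hδ hG P c₀ ℓ hP hgen hc₀ hker hlog
  have hAm := hAq m hm
  -- the anchor
  obtain ⟨d₀, W₀, iE₀, iM₀, C₀, hd₀0, hsq₀, hd₀4, hpar, hmod, hC₀, hr₀, hbsd₀⟩ :=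
    anchor_two_of_inTree_of_kit h0.2.2.1 h0.2.2.2 h4 d hd0 hsq hd4
  obtain ⟨K₀, iF₀, iN₀, v₀, vbar₀, ι₀, cc₀, ψ₀, S₀, κ₀, γ₀, Ω₀, δ₀, Ωp₀, G₀, P₀, c₀₀, ℓ₀, hK₀, hv₀, hvbar₀,
    hne₀, hι₀, hcc₀, hψ₀, hL₀, hS₀, hac₀, hγ₀, hΩ₀, hδ₀, hG₀, hP₀, hgen₀, hc₀₀, hker₀, hlog₀⟩ :=
    stub_katzFrame_two hGZK h0.1 h0.2.1 d₀ hd₀0 hsq₀ hd₀4 W₀ C₀ hC₀ hr₀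
  obtain ⟨q₀, hq₀, hAq₀⟩ := hA d₀ hd₀0 hsq₀ hd₀4 W₀ C₀ hC₀ hr₀ K₀ hK₀ v₀ vbar₀ hv₀ hvbar₀ hne₀ ι₀ hι₀ cc₀
    hcc₀ ψ₀ hψ₀ hL₀ S₀ hS₀ κ₀ γ₀ hac₀ hγ₀ Ω₀ δ₀ Ωp₀ G₀ hΩ₀ hδ₀ hG₀ P₀ c₀₀ ℓ₀ hP₀ hgen₀ hc₀₀ hker₀ hlog₀
  obtain ⟨m₀, hm₀, hBm₀⟩ := hBB d₀ hd₀0 hsq₀ hd₀4 W₀ C₀ hC₀ hr₀ K₀ hK₀ v₀ vbar₀ hv₀ hvbar₀ hne₀ ι₀ hι₀ cc₀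
    hcc₀ ψ₀ hψ₀ hL₀ S₀ hS₀ κ₀ γ₀ hac₀ hγ₀ Ω₀ δ₀ Ωp₀ G₀ hΩ₀ hδ₀ hG₀ P₀ c₀₀ ℓ₀ hP₀ hgen₀ hc₀₀ hker₀ hlog₀
  have hAm₀ := hAq₀ m₀ hm₀
  -- BSD(W₀, 2) pins the anchor's analytic valuation
  obtain ⟨-, -, q₀', hq₀', hv₀'⟩ := hbsd₀
  have hqq : q₀' = q₀ := by exact_mod_cast hq₀'.symm.trans hq₀
  subst hqq
  rw [hmod, hpar] at hAm₀ hBm₀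
  -- conclude BSD(W, 2)
  obtain ⟨hrank, hfin⟩ := hGZK W (by rw [hr])
  refine ⟨hrank, ?_, q, hq, ?_⟩
  · haveI := hfin
    infer_instance
  · omega


/-- **The Rubin road reaches the UPPER half (stmt-BirchSwinnertonDyer-27850) BY NAME** — through the parent and the
conjunct split (`halves_of_splitBadTwoRankOneOfFacts`). Same displayed hypotheses; the one-sided S3 does NOT suffice
(module docstring). [cite: Rubin1992, Cor. 10.3 (shape)] -/
theorem splitBadTwoUpperHalfOfFacts_of_laws
    (h0 : DeShalit1987.thmII414_exists_katzBranch ∧ Deuring_exists_heckeCharacter_of_maximalCM ∧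
      bsdTriple_of_rank_le_one_of_conductor_lt ∧ ModularForms.exists_isNewformOf)
    (h2 : ∃ eA : ℤ → ℤ → ℤ,
      ∀ (d : ℤ), d ≠ 0 → Squarefree d → d % 4 ≠ 1 →
      ∀ (W : WeierstrassCurve ℚ) [W.IsElliptic] [W.IsGloballyMinimal] (C : VariableChange ℚ),
        C • W = cm7.quadraticTwist (d : ℚ) → W.analyticRank = 1 →
      ∀ (K : Type) [Field K] [NumberField K], IsImaginaryQuadratic K →
      ∀ (v vbar : HeightOneSpectrum (𝓞 K)),
        ((2 : ℕ) : 𝓞 K) ∈ v.asIdeal → ((2 : ℕ) : 𝓞 K) ∈ vbar.asIdeal → vbar ≠ v →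
      ∀ (ι : PadicAlgCl 2 ≃+* ℂ),
        (∀ (w : InfinitePlace K) (k : 𝓞 K), k ∈ v.asIdeal ↔ ‖ι.symm (w.embedding (k : K))‖ < 1) →
      ∀ (c : K ≃ₐ[ℚ] K), c ≠ 1 →
      ∀ (ψ : HeckeCharacter K), ψ.HasInfinityType (fun _ ↦ 1) (fun _ ↦ 0) →
        (∀ s : ℂ, 3 / 2 < s.re → heckeLFunction ψ s = W.LSeries s) →
      ∀ (S : Finset (HeightOneSpectrum (𝓞 K))),
        (∀ w : HeightOneSpectrum (𝓞 K), w ∈ S ↔ (¬ ψ.IsUnramifiedAt w ∧ w ≠ v ∧ w ≠ vbar)) →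
      ∀ (κ : ZpExtension K 2) (γ : absoluteGaloisGroup K), κ.IsAnticyclotomic → κ.IsTopGenerator γ →
      ∀ (Ω δ : ℂ) (Ωp : (unrIntegers 2)ˣ) (G : PowerSeries (PadicComplexInt 2)),
        Ω ≠ 0 → (δ ^ 2 = (NumberField.discr K : ℂ) ∨ δ ^ 2 = -(NumberField.discr K : ℂ)) →
        IsKatzBranch ι v vbar S κ γ (HeckeCharacter.galConj c ψ)⁻¹ Ω δ ((Ωp : unrIntegers 2) : ℂ_[2]) G →
      ∀ (P : W.toAffine.Point) (c₀ : ℕ) (ℓ : ℤ),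
        ¬ IsOfFinAddOrder P →
        (∀ R : W.toAffine.Point, ∃ (k : ℤ) (T : W.toAffine.Point), IsOfFinAddOrder T ∧ R = k • P + T) →
        c₀ ≠ 0 → (W.baseChange ℚ_[2]).IsInReductionKernel (c₀ • W.toPadicPoint 2 P) →
        ‖(W.baseChange ℚ_[2]).padicLogPoint (c₀ • W.toPadicPoint 2 P) / (c₀ : ℚ_[2])‖ = (2 : ℝ) ^ (-ℓ) →
      ∃ q : ℚ, shaAn W = (q : ℂ) ∧
        ∀ m : ℤ, ‖((PowerSeries.constantCoeff G : PadicComplexInt 2) : ℂ_[2])‖ = (2 : ℝ) ^ (-(m : ℝ) / 2) →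
          m = 2 * (padicValRat 2 q + (padicValNat 2 W.tamagawaProduct : ℤ)
                - 2 * (padicValNat 2 W.torsionOrder : ℤ) + 2 * ℓ) + eA (d % 2) ((d / (2 - d % 2)) % 8))
    (h3 : ∃ eB : ℤ → ℤ → ℤ,
      ∀ (d : ℤ), d ≠ 0 → Squarefree d → d % 4 ≠ 1 →
      ∀ (W : WeierstrassCurve ℚ) [W.IsElliptic] [W.IsGloballyMinimal] (C : VariableChange ℚ),
        C • W = cm7.quadraticTwist (d : ℚ) → W.analyticRank = 1 →
      ∀ (K : Type) [Field K] [NumberField K], IsImaginaryQuadratic K →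
      ∀ (v vbar : HeightOneSpectrum (𝓞 K)),
        ((2 : ℕ) : 𝓞 K) ∈ v.asIdeal → ((2 : ℕ) : 𝓞 K) ∈ vbar.asIdeal → vbar ≠ v →
      ∀ (ι : PadicAlgCl 2 ≃+* ℂ),
        (∀ (w : InfinitePlace K) (k : 𝓞 K), k ∈ v.asIdeal ↔ ‖ι.symm (w.embedding (k : K))‖ < 1) →
      ∀ (c : K ≃ₐ[ℚ] K), c ≠ 1 →
      ∀ (ψ : HeckeCharacter K), ψ.HasInfinityType (fun _ ↦ 1) (fun _ ↦ 0) →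
        (∀ s : ℂ, 3 / 2 < s.re → heckeLFunction ψ s = W.LSeries s) →
      ∀ (S : Finset (HeightOneSpectrum (𝓞 K))),
        (∀ w : HeightOneSpectrum (𝓞 K), w ∈ S ↔ (¬ ψ.IsUnramifiedAt w ∧ w ≠ v ∧ w ≠ vbar)) →
      ∀ (κ : ZpExtension K 2) (γ : absoluteGaloisGroup K), κ.IsAnticyclotomic → κ.IsTopGenerator γ →
      ∀ (Ω δ : ℂ) (Ωp : (unrIntegers 2)ˣ) (G : PowerSeries (PadicComplexInt 2)),
        Ω ≠ 0 → (δ ^ 2 = (NumberField.discr K : ℂ) ∨ δ ^ 2 = -(NumberField.discr K : ℂ)) →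
        IsKatzBranch ι v vbar S κ γ (HeckeCharacter.galConj c ψ)⁻¹ Ω δ ((Ωp : unrIntegers 2) : ℂ_[2]) G →
      ∀ (P : W.toAffine.Point) (c₀ : ℕ) (ℓ : ℤ),
        ¬ IsOfFinAddOrder P →
        (∀ R : W.toAffine.Point, ∃ (k : ℤ) (T : W.toAffine.Point), IsOfFinAddOrder T ∧ R = k • P + T) →
        c₀ ≠ 0 → (W.baseChange ℚ_[2]).IsInReductionKernel (c₀ • W.toPadicPoint 2 P) →
        ‖(W.baseChange ℚ_[2]).padicLogPoint (c₀ • W.toPadicPoint 2 P) / (c₀ : ℚ_[2])‖ = (2 : ℝ) ^ (-ℓ) →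
      ∃ m : ℤ, ‖((PowerSeries.constantCoeff G : PadicComplexInt 2) : ℂ_[2])‖ = (2 : ℝ) ^ (-(m : ℝ) / 2) ∧
        m = 2 * ((padicValNat 2 (Nat.card (AddCommGroup.primaryComponent W.sha 2)) : ℤ)
              + (padicValNat 2 W.tamagawaProduct : ℤ)
              - 2 * (padicValNat 2 W.torsionOrder : ℤ) + 2 * ℓ) + eB (d % 2) ((d / (2 - d % 2)) % 8))
    (h4 : ∀ (d : ℤ), d ≠ 0 → Squarefree d → d % 4 ≠ 1 → (d / (2 - d % 2)) % 8 ≠ 7 →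
      ∃ (d₀ : ℤ) (W₀ : WeierstrassCurve ℚ) (_ : W₀.IsElliptic) (_ : W₀.IsGloballyMinimal)
        (C₀ : VariableChange ℚ),
        d₀ ≠ 0 ∧ Squarefree d₀ ∧ d₀ % 4 ≠ 1 ∧ d₀ % 2 = d % 2 ∧ (d₀ / (2 - d₀ % 2)) % 8 = (d / (2 - d % 2)) % 8 ∧
        C₀ • W₀ = cm7.quadraticTwist (d₀ : ℚ) ∧ W₀.analyticRank = 1 ∧ BSDp W₀ 2) :
    SplitBadTwoUpperHalfOfFacts :=
  (halves_of_splitBadTwoRankOneOfFacts (splitBadTwoRankOneOfFacts_of_laws h0 h2 h3 h4)).1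

/-- **… and the LOWER half (stmt-BirchSwinnertonDyer-27851) BY NAME.** [cite: Rubin1992, Cor. 10.3 (shape)] -/
theorem splitBadTwoLowerHalfOfFacts_of_laws
    (h0 : DeShalit1987.thmII414_exists_katzBranch ∧ Deuring_exists_heckeCharacter_of_maximalCM ∧
      bsdTriple_of_rank_le_one_of_conductor_lt ∧ ModularForms.exists_isNewformOf)
    (h2 : ∃ eA : ℤ → ℤ → ℤ,
      ∀ (d : ℤ), d ≠ 0 → Squarefree d → d % 4 ≠ 1 →
      ∀ (W : WeierstrassCurve ℚ) [W.IsElliptic] [W.IsGloballyMinimal] (C : VariableChange ℚ),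
        C • W = cm7.quadraticTwist (d : ℚ) → W.analyticRank = 1 →
      ∀ (K : Type) [Field K] [NumberField K], IsImaginaryQuadratic K →
      ∀ (v vbar : HeightOneSpectrum (𝓞 K)),
        ((2 : ℕ) : 𝓞 K) ∈ v.asIdeal → ((2 : ℕ) : 𝓞 K) ∈ vbar.asIdeal → vbar ≠ v →
      ∀ (ι : PadicAlgCl 2 ≃+* ℂ),
        (∀ (w : InfinitePlace K) (k : 𝓞 K), k ∈ v.asIdeal ↔ ‖ι.symm (w.embedding (k : K))‖ < 1) →
      ∀ (c : K ≃ₐ[ℚ] K), c ≠ 1 →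
      ∀ (ψ : HeckeCharacter K), ψ.HasInfinityType (fun _ ↦ 1) (fun _ ↦ 0) →
        (∀ s : ℂ, 3 / 2 < s.re → heckeLFunction ψ s = W.LSeries s) →
      ∀ (S : Finset (HeightOneSpectrum (𝓞 K))),
        (∀ w : HeightOneSpectrum (𝓞 K), w ∈ S ↔ (¬ ψ.IsUnramifiedAt w ∧ w ≠ v ∧ w ≠ vbar)) →
      ∀ (κ : ZpExtension K 2) (γ : absoluteGaloisGroup K), κ.IsAnticyclotomic → κ.IsTopGenerator γ →
      ∀ (Ω δ : ℂ) (Ωp : (unrIntegers 2)ˣ) (G : PowerSeries (PadicComplexInt 2)),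
        Ω ≠ 0 → (δ ^ 2 = (NumberField.discr K : ℂ) ∨ δ ^ 2 = -(NumberField.discr K : ℂ)) →
        IsKatzBranch ι v vbar S κ γ (HeckeCharacter.galConj c ψ)⁻¹ Ω δ ((Ωp : unrIntegers 2) : ℂ_[2]) G →
      ∀ (P : W.toAffine.Point) (c₀ : ℕ) (ℓ : ℤ),
        ¬ IsOfFinAddOrder P →
        (∀ R : W.toAffine.Point, ∃ (k : ℤ) (T : W.toAffine.Point), IsOfFinAddOrder T ∧ R = k • P + T) →
        c₀ ≠ 0 → (W.baseChange ℚ_[2]).IsInReductionKernel (c₀ • W.toPadicPoint 2 P) →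
        ‖(W.baseChange ℚ_[2]).padicLogPoint (c₀ • W.toPadicPoint 2 P) / (c₀ : ℚ_[2])‖ = (2 : ℝ) ^ (-ℓ) →
      ∃ q : ℚ, shaAn W = (q : ℂ) ∧
        ∀ m : ℤ, ‖((PowerSeries.constantCoeff G : PadicComplexInt 2) : ℂ_[2])‖ = (2 : ℝ) ^ (-(m : ℝ) / 2) →
          m = 2 * (padicValRat 2 q + (padicValNat 2 W.tamagawaProduct : ℤ)
                - 2 * (padicValNat 2 W.torsionOrder : ℤ) + 2 * ℓ) + eA (d % 2) ((d / (2 - d % 2)) % 8))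
    (h3 : ∃ eB : ℤ → ℤ → ℤ,
      ∀ (d : ℤ), d ≠ 0 → Squarefree d → d % 4 ≠ 1 →
      ∀ (W : WeierstrassCurve ℚ) [W.IsElliptic] [W.IsGloballyMinimal] (C : VariableChange ℚ),
        C • W = cm7.quadraticTwist (d : ℚ) → W.analyticRank = 1 →
      ∀ (K : Type) [Field K] [NumberField K], IsImaginaryQuadratic K →
      ∀ (v vbar : HeightOneSpectrum (𝓞 K)),
        ((2 : ℕ) : 𝓞 K) ∈ v.asIdeal → ((2 : ℕ) : 𝓞 K) ∈ vbar.asIdeal → vbar ≠ v →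
      ∀ (ι : PadicAlgCl 2 ≃+* ℂ),
        (∀ (w : InfinitePlace K) (k : 𝓞 K), k ∈ v.asIdeal ↔ ‖ι.symm (w.embedding (k : K))‖ < 1) →
      ∀ (c : K ≃ₐ[ℚ] K), c ≠ 1 →
      ∀ (ψ : HeckeCharacter K), ψ.HasInfinityType (fun _ ↦ 1) (fun _ ↦ 0) →
        (∀ s : ℂ, 3 / 2 < s.re → heckeLFunction ψ s = W.LSeries s) →
      ∀ (S : Finset (HeightOneSpectrum (𝓞 K))),
        (∀ w : HeightOneSpectrum (𝓞 K), w ∈ S ↔ (¬ ψ.IsUnramifiedAt w ∧ w ≠ v ∧ w ≠ vbar)) →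
      ∀ (κ : ZpExtension K 2) (γ : absoluteGaloisGroup K), κ.IsAnticyclotomic → κ.IsTopGenerator γ →
      ∀ (Ω δ : ℂ) (Ωp : (unrIntegers 2)ˣ) (G : PowerSeries (PadicComplexInt 2)),
        Ω ≠ 0 → (δ ^ 2 = (NumberField.discr K : ℂ) ∨ δ ^ 2 = -(NumberField.discr K : ℂ)) →
        IsKatzBranch ι v vbar S κ γ (HeckeCharacter.galConj c ψ)⁻¹ Ω δ ((Ωp : unrIntegers 2) : ℂ_[2]) G →
      ∀ (P : W.toAffine.Point) (c₀ : ℕ) (ℓ : ℤ),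
        ¬ IsOfFinAddOrder P →
        (∀ R : W.toAffine.Point, ∃ (k : ℤ) (T : W.toAffine.Point), IsOfFinAddOrder T ∧ R = k • P + T) →
        c₀ ≠ 0 → (W.baseChange ℚ_[2]).IsInReductionKernel (c₀ • W.toPadicPoint 2 P) →
        ‖(W.baseChange ℚ_[2]).padicLogPoint (c₀ • W.toPadicPoint 2 P) / (c₀ : ℚ_[2])‖ = (2 : ℝ) ^ (-ℓ) →
      ∃ m : ℤ, ‖((PowerSeries.constantCoeff G : PadicComplexInt 2) : ℂ_[2])‖ = (2 : ℝ) ^ (-(m : ℝ) / 2) ∧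
        m = 2 * ((padicValNat 2 (Nat.card (AddCommGroup.primaryComponent W.sha 2)) : ℤ)
              + (padicValNat 2 W.tamagawaProduct : ℤ)
              - 2 * (padicValNat 2 W.torsionOrder : ℤ) + 2 * ℓ) + eB (d % 2) ((d / (2 - d % 2)) % 8))
    (h4 : ∀ (d : ℤ), d ≠ 0 → Squarefree d → d % 4 ≠ 1 → (d / (2 - d % 2)) % 8 ≠ 7 →
      ∃ (d₀ : ℤ) (W₀ : WeierstrassCurve ℚ) (_ : W₀.IsElliptic) (_ : W₀.IsGloballyMinimal)
        (C₀ : VariableChange ℚ),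
        d₀ ≠ 0 ∧ Squarefree d₀ ∧ d₀ % 4 ≠ 1 ∧ d₀ % 2 = d % 2 ∧ (d₀ / (2 - d₀ % 2)) % 8 = (d / (2 - d % 2)) % 8 ∧
        C₀ • W₀ = cm7.quadraticTwist (d₀ : ℚ) ∧ W₀.analyticRank = 1 ∧ BSDp W₀ 2) :
    SplitBadTwoLowerHalfOfFacts :=
  (halves_of_splitBadTwoRankOneOfFacts (splitBadTwoRankOneOfFacts_of_laws h0 h2 h3 h4)).2

end Summit.BirchSwinnertonDyer.BirchSwinnertonDyer.Theorems.PrintCf2.RubinValueTwo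

end
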